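import Summits.HubbardSuperconductivity.HubbardSuperconductivity.Theorems.HyperoctahedralMottCompleteGraphAnchorCAR

/-!
# Route `HyperoctahedralMott`, support `CompleteGraphAnchor` (item stmt-HubbardSuperconductivity-6677):
# resummation over the complete graph

Helper file 2/6 for the complete-graph anchor: ordered-pair sums over `K_n`, the sector
bookkeeping (`N↑`, `N↓` on a Gutzwiller `(N, S^z)` sector), and the resummed pieces of the swap
expectation — hopping (`Σ_x Σ_y ⟨c†_{xσ}c_{yσ}⟩ = n‖ψ‖² - ‖P C_σ† ψ‖² - ⟨N_σ̄⟩`, via the doublon part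
of `C_σ† ψ`) and the pair-density double sum. No definitions. Physics context: the `gl(1|2)`
Casimir of the supersymmetric `t`-`J` model on the complete graph (Sarkar 1991; Essler–Korepin
1992); here everything is elementary CAR algebra in the tree's Jordan–Wigner model.
-/

-- the mandated namespace `Summit.<Summit>.<Problem>.Theorems` repeats `HubbardSuperconductivity`
-- (single-problem summit, D-0017), which the `dupNamespace` linter flags on every declaration
set_option linter.dupNamespace false

noncomputable section

namespace Summit.HubbardSuperconductivity.HubbardSuperconductivity.Theorems.HyperoctahedralMott.Anchor

open Matrix Finset Literature.MathematicalPhysics.QuantumLattice HubbardWave0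
open scoped ComplexOrder

variable {Λ : Type*} [LinearOrder Λ] [Fintype Λ]

/-! ### Ordered-pair sums over the complete graph -/

/-- A sum over the ordered edges of `K_Λ` is the full double sum minus the diagonal. [folklore] -/
theorem sum_top_adj_eq {M : Type*} [AddCommGroup M] (f : Λ → Λ → M) :
    (∑ x, ∑ y, if (⊤ : SimpleGraph Λ).Adj x y then f x y else 0) = (∑ x, ∑ y, f x y) - ∑ x, f x x := by
  rw [← Finset.sum_sub_distrib]
  refine Finset.sum_congr rfl fun x _ => ?_
  have h : ∀ y, f x y = (if (⊤ : SimpleGraph Λ).Adj x y then f x y else 0) + (if x = y then f x y else 0) := by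
    intro y
    by_cases hxy : x = y
    · subst hxy
      simp
    · rw [if_neg hxy, add_zero, if_pos ((SimpleGraph.top_adj x y).2 hxy)]
  rw [Finset.sum_congr rfl fun y _ => h y, Finset.sum_add_distrib, Finset.sum_ite_eq,
    if_pos (Finset.mem_univ x), add_sub_cancel_right]

/-- `Σ_{x≠y} (g x + g y) = 2 (|Λ| - 1) Σ_x g x`. [folklore] -/
theorem sum_top_adj_add_eq (g : Λ → ℂ) :
    (∑ x, ∑ y, if (⊤ : SimpleGraph Λ).Adj x y then g x + g y else 0) =
      2 * ((Fintype.card Λ : ℂ) - 1) * ∑ x, g x := by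
  rw [sum_top_adj_eq]
  simp only [Finset.sum_add_distrib, Finset.sum_const, Finset.card_univ, nsmul_eq_mul]
  rw [← Finset.mul_sum]
  ring

/-! ### Sector bookkeeping -/

/-- `Σ_x n_{x↑}` multiplies an amplitude by the number of up spins. [folklore] -/
theorem sum_numberOp_up_mulVec_apply (ψ : Fock (Orb Λ)) (s : Finset (Orb Λ)) :
    ((∑ x : Λ, numberOp x 0) *ᵥ ψ) s = (upCount s : ℂ) * ψ s := by
  rw [sum_mulVec, Finset.sum_apply]
  simp_rw [LiebTwo.numberOp_mulVec]
  rw [← Finset.sum_filter, Finset.sum_const, nsmul_eq_mul, upCount]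

/-- `Σ_x n_{x↓}` multiplies an amplitude by the number of down spins. [folklore] -/
theorem sum_numberOp_down_mulVec_apply (ψ : Fock (Orb Λ)) (s : Finset (Orb Λ)) :
    ((∑ x : Λ, numberOp x 1) *ᵥ ψ) s = (NagaokaTasaki.downCount s : ℂ) * ψ s := by
  rw [sum_mulVec, Finset.sum_apply]
  simp_rw [LiebTwo.numberOp_mulVec]
  rw [← Finset.sum_filter, Finset.sum_const, nsmul_eq_mul, NagaokaTasaki.downCount]

/-- **Spin counts on a Gutzwiller `(N, S^z = M)` sector.** If `M = (N↑ - N↓)/2` with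
`N↑ + N↓ = N`, every configuration in the support of a Gutzwiller `N`-particle `S^z = M`
eigenvector carries exactly `N↑` up and `N↓` down spins. [folklore] -/
theorem counts_of_sector {ψ : Fock (Orb Λ)} (hG : IsGutzwiller ψ) {N : ℕ} (hN : IsNParticle N ψ)
    {M : ℝ} (hS : spinZ *ᵥ ψ = (M : ℂ) • ψ) {Nup Ndn : ℕ} (hsum : Nup + Ndn = N)
    (hM : 2 * M = (Nup : ℝ) - Ndn) {s : Finset (Orb Λ)} (hs : ψ s ≠ 0) :
    upCount s = Nup ∧ NagaokaTasaki.downCount s = Ndn := by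
  have hcard : s.card = N := by
    by_contra h
    exact hs (hN s h)
  have hdbl : ¬ HasDoubleOccupancy s := fun h => hs (hG s h)
  have h1 : upCount s + NagaokaTasaki.downCount s = Nup + Ndn := by
    rw [NagaokaTasaki.upCount_add_downCount hdbl, hcard, hsum]
  have h2 := congrFun hS s
  rw [NagaokaTasaki.spinZ_mulVec_apply, Pi.smul_apply, smul_eq_mul] at h2
  have h3 : (1 / 2 : ℂ) * ((upCount s : ℂ) - NagaokaTasaki.downCount s) = (M : ℂ) :=
    mul_right_cancel₀ hs h2
  have h4 : ((upCount s : ℝ) - NagaokaTasaki.downCount s) = (Nup : ℝ) - Ndn := by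
    have h3' := congrArg Complex.re h3
    simp only [Complex.mul_re, Complex.sub_re, Complex.natCast_re, Complex.ofReal_re,
      Complex.sub_im, Complex.natCast_im, sub_self, mul_zero, sub_zero] at h3'
    norm_num at h3'
    linarith
  have h1' : ((upCount s : ℝ) + NagaokaTasaki.downCount s) = (Nup : ℝ) + Ndn := by
    exact_mod_cast h1
  have hu : (upCount s : ℝ) = Nup := by linarith
  have hd : (NagaokaTasaki.downCount s : ℝ) = Ndn := by linarith
  exact ⟨by exact_mod_cast hu, by exact_mod_cast hd⟩

/-- On such a sector `Σ_x n_{x↑}` acts as the scalar `N↑`. [folklore] -/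
theorem sum_numberOp_up_mulVec_of_counts {ψ : Fock (Orb Λ)} {Nup Ndn : ℕ}
    (h : ∀ s, ψ s ≠ 0 → upCount s = Nup ∧ NagaokaTasaki.downCount s = Ndn) :
    (∑ x : Λ, numberOp x 0) *ᵥ ψ = (Nup : ℂ) • ψ := by
  funext s
  rw [sum_numberOp_up_mulVec_apply, Pi.smul_apply, smul_eq_mul]
  by_cases hs : ψ s = 0
  · rw [hs, mul_zero, mul_zero]
  · rw [(h s hs).1]

/-- On such a sector `Σ_x n_{x↓}` acts as the scalar `N↓`. [folklore] -/
theorem sum_numberOp_down_mulVec_of_counts {ψ : Fock (Orb Λ)} {Nup Ndn : ℕ}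
    (h : ∀ s, ψ s ≠ 0 → upCount s = Nup ∧ NagaokaTasaki.downCount s = Ndn) :
    (∑ x : Λ, numberOp x 1) *ᵥ ψ = (Ndn : ℂ) • ψ := by
  funext s
  rw [sum_numberOp_down_mulVec_apply, Pi.smul_apply, smul_eq_mul]
  by_cases hs : ψ s = 0
  · rw [hs, mul_zero, mul_zero]
  · rw [(h s hs).2]

/-! ### The doublon part of `C_σ† ψ` -/

/-- `n_{xσ}` is self-adjoint. [folklore] -/
theorem numberOp_conjTranspose (x : Λ) (σ : Fin 2) :
    (numberOp x σ : Matrix (Finset (Orb Λ)) (Finset (Orb Λ)) ℂ)ᴴ = numberOp x σ := by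
  rw [numberOp, conjTranspose_mul, creation_conjTranspose, annihilation_conjTranspose]

/-- For `x ≠ y` the cross term `(c_{xσ} n_{xτ})(n_{yτ} c†_{yσ})` has vanishing Gutzwiller
expectation (it creates a doublon at `y`). [folklore] -/
theorem expect_doublonCross_eq_zero {ψ : Fock (Orb Λ)} (hG : IsGutzwiller ψ) {x y : Λ}
    (hxy : x ≠ y) {σ τ : Fin 2} (hστ : σ ≠ τ) :
    star ψ ⬝ᵥ ((annihilation (orb x σ) * numberOp x τ * (numberOp y τ * creation (orb y σ))) *ᵥ ψ) = 0 := by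
  have hP : gutzwillerProj *ᵥ ψ = ψ := (gutzwillerProj_mulVec_eq_self_iff ψ).2 hG
  -- reorder: `c_{xσ} n_{xτ} n_{yτ} c†_{yσ} = -(n_{yτ} c†_{yσ}) (c_{xσ} n_{xτ})`
  have hxy' : orb x σ ≠ orb y σ := EtaPairingODLRO.orb_ne_orb_of_ne hxy σ σ
  have h1 : annihilation (orb x σ) * creation (orb y σ) = -(creation (orb y σ) * annihilation (orb x σ)) :=
    SusyTJ.annihilation_mul_creation_of_ne hxy'
  have h2 : numberOp x τ * creation (orb y σ) = creation (orb y σ) * numberOp x τ := by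
    rw [numberOp, number_mul_creation_of_ne (EtaPairingODLRO.orb_ne_orb_of_ne hxy τ σ)]
  have h3 : annihilation (orb x σ) * numberOp y τ = numberOp y τ * annihilation (orb x σ) := by
    rw [numberOp, SusyTJ.number_mul_annihilation_of_ne (EtaPairingODLRO.orb_ne_orb_of_ne hxy.symm τ σ)]
  have h4 : numberOp x τ * numberOp y τ = numberOp y τ * numberOp x τ := by
    rw [numberOp, numberOp, SusyTJ.number_mul_number_comm]
  have hre : annihilation (orb x σ) * numberOp x τ * (numberOp y τ * creation (orb y σ)) =
      -(numberOp y τ * creation (orb y σ) * (annihilation (orb x σ) * numberOp x τ)) := by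
    calc annihilation (orb x σ) * numberOp x τ * (numberOp y τ * creation (orb y σ))
        = annihilation (orb x σ) * (numberOp x τ * numberOp y τ) * creation (orb y σ) := by noncomm_ring
      _ = (annihilation (orb x σ) * numberOp y τ) * (numberOp x τ * creation (orb y σ)) := by
          rw [h4]; noncomm_ring
      _ = numberOp y τ * (annihilation (orb x σ) * creation (orb y σ)) * numberOp x τ := by
          rw [h3, h2]; noncomm_ring
      _ = -(numberOp y τ * creation (orb y σ) * (annihilation (orb x σ) * numberOp x τ)) := by
          rw [h1]; noncomm_ring
  have hkill : (gutzwillerProj : Matrix (Finset (Orb Λ)) (Finset (Orb Λ)) ℂ) *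
      (numberOp y τ * creation (orb y σ) * (annihilation (orb x σ) * numberOp x τ)) = 0 := by
    rw [← Matrix.mul_assoc, gutzwillerProj_mul_number_mul_creation y hστ, Matrix.zero_mul]
  rw [← expect_sandwich hP, hre, mul_neg, hkill, neg_zero, Matrix.zero_mul, zero_mulVec,
    dotProduct_zero]

/-- The diagonal term `(c_{xσ} n_{xτ})(n_{xτ} c†_{xσ}) = n_{xτ} - n_{xτ} n_{xσ}`. [folklore] -/
theorem doublonDiag_eq (x : Λ) {σ τ : Fin 2} (hστ : σ ≠ τ) :
    annihilation (orb x σ) * numberOp x τ * (numberOp x τ * creation (orb x σ)) =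
      numberOp x τ - numberOp x τ * numberOp x σ := by
  have hne : orb x τ ≠ orb x σ := fun h => hστ (orb_inj.1 h).2.symm
  have h3 : annihilation (orb x σ) * numberOp x τ = numberOp x τ * annihilation (orb x σ) := by
    rw [numberOp, SusyTJ.number_mul_annihilation_of_ne hne]
  have h5 : numberOp x τ * numberOp x τ = numberOp x τ := by
    rw [numberOp, SusyTJ.number_mul_number_self]
  calc annihilation (orb x σ) * numberOp x τ * (numberOp x τ * creation (orb x σ))
      = annihilation (orb x σ) * (numberOp x τ * numberOp x τ) * creation (orb x σ) := by
        noncomm_ring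
    _ = numberOp x τ * (annihilation (orb x σ) * creation (orb x σ)) := by rw [h5, h3, mul_assoc]
    _ = numberOp x τ * (1 - creation (orb x σ) * annihilation (orb x σ)) := by
        rw [annihilation_mul_creation, if_pos rfl]
    _ = numberOp x τ - numberOp x τ * numberOp x σ := by rw [mul_sub, mul_one]; rfl

/-- A product of the two number operators at one site kills a Gutzwiller vector, either order.
[folklore] -/
theorem numberOp_mul_numberOp_mulVec_eq_zero {ψ : Fock (Orb Λ)} (hG : IsGutzwiller ψ) (x : Λ)
    {σ τ : Fin 2} (hστ : σ ≠ τ) : (numberOp x τ * numberOp x σ) *ᵥ ψ = 0 := by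
  have h01 : ∀ ρ : Fin 2, ρ = 0 ∨ ρ = 1 := by decide
  rcases h01 σ with rfl | rfl <;> rcases h01 τ with rfl | rfl
  · exact absurd rfl hστ
  · rw [numberOp, numberOp, SusyTJ.number_mul_number_comm]
    exact doublon_mulVec_eq_zero hG x
  · exact doublon_mulVec_eq_zero hG x
  · exact absurd rfl hστ

/-- **The doublon part of `C_σ† ψ` has norm `⟨ψ, N_τ ψ⟩`** (`τ` the opposite spin):
`‖Σ_y n_{yτ} c†_{yσ} ψ‖² = ⟨ψ, (Σ_x n_{xτ}) ψ⟩` for Gutzwiller `ψ`. [folklore] -/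
theorem doublonPart_normSq {ψ : Fock (Orb Λ)} (hG : IsGutzwiller ψ) {σ τ : Fin 2} (hστ : σ ≠ τ) :
    star ((∑ y : Λ, numberOp y τ * creation (orb y σ)) *ᵥ ψ) ⬝ᵥ
        ((∑ y : Λ, numberOp y τ * creation (orb y σ)) *ᵥ ψ) =
      star ψ ⬝ᵥ ((∑ x : Λ, numberOp x τ) *ᵥ ψ) := by
  rw [star_mulVec_dotProduct_mulVec, conjTranspose_sum]
  have hct : ∀ x : Λ, (numberOp x τ * creation (orb x σ))ᴴ = annihilation (orb x σ) * numberOp x τ := by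
    intro x
    rw [conjTranspose_mul, creation_conjTranspose, numberOp_conjTranspose]
  simp_rw [hct]
  rw [Finset.sum_mul_sum, sum_mulVec, dotProduct_sum, sum_mulVec, dotProduct_sum]
  refine Finset.sum_congr rfl fun x _ => ?_
  rw [sum_mulVec, dotProduct_sum, Finset.sum_eq_single x]
  · rw [doublonDiag_eq x hστ, sub_mulVec, numberOp_mul_numberOp_mulVec_eq_zero hG x hστ, sub_zero]
  · intro y _ hyx
    exact expect_doublonCross_eq_zero hG (Ne.symm hyx) hστ
  · exact fun h => absurd (Finset.mem_univ x) h

/-- `(1 - P) C_σ† ψ = Σ_y n_{yτ} c†_{yσ} ψ` for Gutzwiller `ψ`. [folklore] -/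
theorem doublonPart_eq {ψ : Fock (Orb Λ)} (hG : IsGutzwiller ψ) {σ τ : Fin 2} (hστ : σ ≠ τ) :
    (1 - gutzwillerProj) *ᵥ ((∑ y : Λ, creation (orb y σ)) *ᵥ ψ) =
      (∑ y : Λ, numberOp y τ * creation (orb y σ)) *ᵥ ψ := by
  rw [sub_mulVec, one_mulVec, sum_mulVec, sum_mulVec, mulVec_sum]
  rw [← Finset.sum_sub_distrib]
  refine Finset.sum_congr rfl fun y _ => ?_
  rw [gutzwillerProj_creation_mulVec hG y hστ, ← mulVec_mulVec, sub_sub_cancel]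

/-- **Resummed hopping**: `Σ_x Σ_y ⟨ψ, c†_{xσ} c_{yσ} ψ⟩ = |Λ| ‖ψ‖² - ‖P C_σ† ψ‖² - ⟨ψ, N_τ ψ⟩`
for Gutzwiller `ψ` (`τ` the opposite spin). [folklore] -/
theorem sum_sum_expect_hop {ψ : Fock (Orb Λ)} (hG : IsGutzwiller ψ) {σ τ : Fin 2} (hστ : σ ≠ τ) :
    (∑ x : Λ, ∑ y : Λ, star ψ ⬝ᵥ ((creation (orb x σ) * annihilation (orb y σ)) *ᵥ ψ)) =
      (Fintype.card Λ : ℂ) * (star ψ ⬝ᵥ ψ) -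
        star (gutzwillerProj *ᵥ ((∑ x : Λ, creation (orb x σ)) *ᵥ ψ)) ⬝ᵥ
          (gutzwillerProj *ᵥ ((∑ x : Λ, creation (orb x σ)) *ᵥ ψ)) -
        star ψ ⬝ᵥ ((∑ x : Λ, numberOp x τ) *ᵥ ψ) := by
  rw [← zeroMomentum_normSq_eq_sum, ← zeroMomentum_norm_add σ ψ,
    star_dotProduct_self_eq_add_of_proj gutzwillerProj_conjTranspose gutzwillerProj_mul_self
      ((∑ x : Λ, creation (orb x σ)) *ᵥ ψ),
    doublonPart_eq hG hστ, doublonPart_normSq hG hστ]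
  ring

/-- The diagonal of the hopping double sum: `Σ_x ⟨ψ, c†_{xσ} c_{xσ} ψ⟩ = ⟨ψ, N_σ ψ⟩`. [folklore] -/
theorem sum_expect_hop_diag (ψ : Fock (Orb Λ)) (σ : Fin 2) :
    (∑ x : Λ, star ψ ⬝ᵥ ((creation (orb x σ) * annihilation (orb x σ)) *ᵥ ψ)) =
      star ψ ⬝ᵥ ((∑ x : Λ, numberOp x σ) *ᵥ ψ) := by
  rw [sum_mulVec, dotProduct_sum]
  rfl

/-! ### More ordered-pair sums -/

/-- Symmetrised ordered-edge sums: `Σ_{x≠y} (f x y + f y x) = 2 Σ_{x≠y} f x y`. [folklore] -/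
theorem sum_top_adj_add_swap (f : Λ → Λ → ℂ) :
    (∑ x, ∑ y, if (⊤ : SimpleGraph Λ).Adj x y then f x y + f y x else 0) =
      2 * ∑ x, ∑ y, if (⊤ : SimpleGraph Λ).Adj x y then f x y else 0 := by
  rw [sum_top_adj_eq, sum_top_adj_eq]
  simp only [Finset.sum_add_distrib]
  rw [Finset.sum_comm (f := fun x y => f y x)]
  ring

/-- Ordered-edge sums only see the off-diagonal values. [folklore] -/
theorem sum_top_adj_congr {M : Type*} [AddCommMonoid M] {f g : Λ → Λ → M}
    (h : ∀ x y, x ≠ y → f x y = g x y) :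
    (∑ x, ∑ y, if (⊤ : SimpleGraph Λ).Adj x y then f x y else 0) =
      ∑ x, ∑ y, if (⊤ : SimpleGraph Λ).Adj x y then g x y else 0 :=
  Finset.sum_congr rfl fun x _ => Finset.sum_congr rfl fun y _ => by
    by_cases hxy : (⊤ : SimpleGraph Λ).Adj x y
    · rw [if_pos hxy, if_pos hxy, h x y ((SimpleGraph.top_adj x y).1 hxy)]
    · rw [if_neg hxy, if_neg hxy]

/-- The double sum of `⟨n_{x↑} n_{y↓}⟩`. [folklore] -/
theorem sum_sum_expect_numberOp_mul (ψ : Fock (Orb Λ)) :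
    (∑ x : Λ, ∑ y : Λ, star ψ ⬝ᵥ ((numberOp x 0 * numberOp y 1) *ᵥ ψ)) =
      star ψ ⬝ᵥ ((∑ x : Λ, numberOp x 0) *ᵥ ((∑ y : Λ, numberOp y 1) *ᵥ ψ)) := by
  rw [mulVec_mulVec, Finset.sum_mul_sum, sum_mulVec, dotProduct_sum]
  refine Finset.sum_congr rfl fun x _ => ?_
  rw [sum_mulVec, dotProduct_sum]

end Summit.HubbardSuperconductivity.HubbardSuperconductivity.Theorems.HyperoctahedralMott.Anchor
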